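import Summits.QuantumFields.YangMills.Theorems.BalabanUVNodesN12ForestSliceOfProxies
import Summits.QuantumFields.YangMills.Theorems.BalabanUVNodesN12ForestProjectionL1Letter
import Summits.QuantumFields.YangMills.Theorems.BalabanUVNodesN12NearFlatChartLetterBookkeeping
import Literature.MathematicalPhysics.QuantumFieldTheory.Balaban1983to89.Node00.MultiScaleFibreChartLocalityComponent
import HarnessLib

/-!
# BalabanUVNodes ∕ N12 — SLICE-VALUED PREIMAGES OF `DΨ_{U₀}(0)` WITH AN `ℓ¹` LETTER AND THEIR LEVEL-`0` SUPPORT: g11's forest preimage at an unguarded base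
# (`N12ForestSliceOfProxies.exists_forest_preimage_of_surjective_proxies`) fed by this lineage's LETTERED (45) right inverse instead of bare surjectivity
# ([Balaban1985Variational] (4) p. 278, Sect. C (44)–(48) p. 285, (82)–(83) p. 290; [Balaban1988Convergent] (2.2) p. 255, (2.10)–(2.13) pp. 256–257)

Cell `pub-ymgap` (HUMAN RULINGS D-0062 ∕ D-0149), WIDTH SEAT `pub-ymgap-dag-n12-w6` g14 (node N12 = [B15]; key K1⁹ `stmt-QuantumFields-27364`, `--kind proof --supports … --as helper`;
count-neutral; bus 2026-08-29 DAGN12W6-G14 CLAIM-2, file B).  THEOREMS ONLY (0 `def`, 0 `instance`, 0 `sorry`).  CONSUMED BY NAME, nothing modified: this seat's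
`N12ForestProjectionL1Letter.exists_forestProjection_l1` (file A, p7108xx), g11's `N12ForestSliceOfProxies.fderiv_msChart_orbitTangent_apply_eq_zero_of_sharpProxy` ∕
`embIter_iterBlockOf_of_eq_zero` (p706207), g7's `N12DirectSurjHsurjProxiesPrelim.fderiv_msChart_apply_eq_zero_of_vanish_sharp'` (p678568), dag-n12-w4's
`Node00.fderiv_msChart_apply_levelZero` («the Γ₀ layer of the linearised constraint is the evaluation») and ℓ²(HS) bookkeeping `N12NearFlatChartLetter.sum_opNorm_le_sqrt_card_mul_l2Seminorm` ∕
`l2Seminorm_apply` (p629850), g11's class-fed right inverse `N12HsurjOfClass.exists_rightInverse_Bj_of_isMinimizer_class` (p705019).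

WHY.  (R1a) of the multiplier letter (p710811 `multiplierLetter_of_rightInverseOn`) asks, per base field, SLICE-VALUED preimages whose real part is supported in `Ω₁(Z)`'s bonds with an `ℓ¹`
letter chosen ONCE PER HEIGHT.  g11 makes preimages slice-valued at an unguarded base (forest projection kills nothing in the image: the orbit tangent of a residual vanishing at the
roots lies in `ker DΨ_{U₀}(0)`, row by row through sharp proxies), but from bare surjectivity — no size.  THIS FILE threads the size through: the projection's `ℓ¹(op)` letter
`(1 + 2·#bonds·Lp)` (file A) times the right inverse's `ℓ²(HS)` letter `B` (p678596 ∕ p690553 ∕ p705019: `√(Σ_b‖H v b‖²) ≤ B‖v‖`) times `√#bonds` (Cauchy–Schwarz).  And the SUPPORT: a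
preimage of a datum vanishing on the level-`0` rows vanishes on every `Γ₀`-bond, because the `Γ₀` layer of `DΨ_{U₀}(0)` is the evaluation — at the record (`𝐁_k(Z)`, `0 < k`) on every bond
with an end-point off `Ω₁(Z)`.

CONTENTS (namespace `Summit.QuantumFields.YangMills.BalabanUVNodes.N12ForestPreimageL1Letter`).
* §1 ★★ `exists_forest_preimage_l1_of_proxies` — general `𝐁`, datum `W`, `U₀` in its fibre, chart differentiable at `0`, per-row sharp proxies for positive levels, rooted forest with (F1)
  and `hlen`: EVERY field `X₀` has a slice-valued companion `X` with the SAME image under `DΨ_{U₀}(0)` and `Σ_b‖↑X_b‖_op ≤ (1 + 2·#bonds·Lp)·Σ_b‖↑X₀,b‖_op`.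
* §2 ★★ `exists_forest_preimage_l1_of_rightInverse` — with a lettered right inverse `(H, hHinv, hHB)`: every datum `τ` has a slice-valued preimage with
  `Σ_b‖↑X_b‖_op ≤ ((1 + 2·#bonds·Lp)·√#bonds·B)·‖τ‖`; `apply_eq_zero_of_preimage_levelZero` (a preimage of a datum vanishing at the level-`0` row of `c ∈ bondsOf (𝐁 0)` vanishes at `c`);
  ★★ `exists_forest_preimage_l1_support_of_rightInverse` (both together: preimage, `ℓ¹` letter, and `X = 0` on every `Γ₀`-bond whose row the datum does not charge).
* §3 ★★★ `exists_forest_preimage_l1_support_Bj_of_isMinimizer_class` — at the record `𝐁_k(Z)`, `0 < k`, for EVERY (2.12)-class minimiser `U₀` and datum `W` with `U₀` in its fibre: the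
  same with the proxies and `H` READ OFF THE CLASS (p705019 ∕ ρ5b ∕ §3b), the support clause on every bond with SOURCE off `Ω₁(Z)` (`Γ₀ = Ω₁ᶜ`); per-height letters only (`hHB`'s ∀-body,
  `hsbU`, floors, `Lp`).

HONEST FRAMING.  Bookkeeping by name + finite sums; per-height (volume-dependent) EXISTENCE letters — print's volume-uniform (46) NOT claimed; the velocity ∕ `DΦ₀(0)` re-currencying of
these preimages for the (J0′) producer's slice datum coordinates is file C; nothing of Bałaban's asserted; N12 NOT discharged; K1⁹ NOT closed; counts of record unmoved (typed 28∕28 ·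
discharged 8∕27); one finite 𝕋⁴ programme at fixed ε — R4 closes the conditional rung `BalabanLadder.UV` only; no summit statement is proved here and NOT the Yang–Mills mass gap (Clay);
nothing continuum ∕ ℝ⁴ ∕ OS.
-/

noncomputable section

namespace Summit.QuantumFields.YangMills.BalabanUVNodes.N12ForestPreimageL1Letter

open scoped BigOperators Matrix.Norms.L2Operator Topology
open Literature.MathematicalPhysics.QuantumFieldTheory.Balaban1983to89
open T4Continuum
open B15DeterminingSets GaugeField
open ExpMeanLog (expMeanLogSU)
open T4AdjointCovarianceUnitary (lieSU specialUnitaryAd coe_specialUnitaryAd)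
open Node00
open B5Eq118OneStroke (iterBlockOf)
open B14.Eq213DetSet (Bj maxDomT)
open B14.Eq213MaximalDomains (side)
open B14.Eq216Concrete (feeds)
open B15Eq112TorusCover (lift)
open T4AxialGaugeSmallField (boxPlaqs)
open T4CubeChartGnomonic (SU2)
open Summit.QuantumFields.YangMills.BalabanUVNodes.N12ForestSliceOfProxies (fderiv_msChart_orbitTangent_apply_eq_zero_of_sharpProxy embIter_iterBlockOf_of_eq_zero)
open Summit.QuantumFields.YangMills.BalabanUVNodes.N12DirectSurjHsurjProxiesPrelim (fderiv_msChart_apply_eq_zero_of_vanish_sharp' differentiableAt_msChart_of_towerProxies)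
open Summit.QuantumFields.YangMills.BalabanUVNodes.N12ForestProjectionL1Letter (exists_forestProjection_l1)
open Summit.QuantumFields.YangMills.BalabanUVNodes.N12NearFlatChartLetter (sum_opNorm_le_sqrt_card_mul_l2Seminorm l2Seminorm_apply)
open Summit.QuantumFields.YangMills.BalabanUVNodes.N12HsurjOfClass (exists_rightInverse_Bj_of_isMinimizer_class)
open Summit.QuantumFields.YangMills.BalabanUVNodes.N12TowerProxiesOfClass (towerProxies_Bj_of_mem_class)
open Summit.QuantumFields.YangMills.BalabanUVNodes.N12SiteProxiesOfClass (siteProxies_Bj_of_mem_class)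
open Summit.QuantumFields.YangMills.BalabanUVNodes.N12DirectSurjHsurjPrelim (inner_endpoint_of_mem_bondsOf_Bj)

variable {F : T4Family} {N : ℕ} [NeZero N] {K k : ℕ}

/-! ## §1  Slice-valued companions with the same image and an `ℓ¹(op)` letter -/

section Companion

/-- ★★ **SLICE-VALUED COMPANION WITH THE SAME IMAGE AND AN `ℓ¹` LETTER** (g11's `exists_forest_preimage_of_surjective_proxies` with the size threaded through): general determining
set `𝐁`, datum `W` with `U₀` in its fibre, `Ψ_{𝐁,W,U₀}` differentiable at `0`, one guarded sharp proxy per row of positive level, a rooted forest with (F1) whose roots contain the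
centres `R(𝐁, k)` and whose paths have length `≤ Lp`.  Then every bond field `X₀` has a companion `X` VANISHING ON EVERY PATH BOND with `DΨ(0) X = DΨ(0) X₀` and
`Σ_b‖↑X_b‖_op ≤ (1 + 2·#bonds·Lp)·Σ_b‖↑X₀,b‖_op` — the forest projection of file A (its orbit tangent is killed row by row: level `0` by vanishing on the sharp tower, positive levels at
the proxy). [cite: Balaban1985Variational, (4) p.278, (16)–(18) p.280, (45)–(48) p.285, (82)–(83) p.290; Balaban1988Convergent, (2.10)–(2.11) p.256] -/
theorem exists_forest_preimage_l1_of_proxies (𝔹 : DetSet (F.P K)) (hk : k ≤ (F.P K).m + (F.P K).K)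
    {W : MSField (F.P K) (SU N)} {U₀ : GaugeField (F.P K) 0 (SU N)} (hU : AgreeOn 𝔹 (avgFamily (avOfRecord F N K) U₀) W)
    (hΨ : DifferentiableAt ℝ (msChart F N K k 𝔹 W U₀) 0)
    (hsharp : ∀ i : Fin (constrCard 𝔹 k), 1 ≤ (((constrEnum 𝔹 k).symm i).1 : ℕ) → ∃ U' : GaugeField (F.P K) 0 (SU N),
      SmallBelow (avOfRecord F N K) k U' ∧ ∀ b₀ : PBond (F.P K) 0,
        (iterBlockOf (((constrEnum 𝔹 k).symm i).1 : ℕ) b₀.src = ((constrEnum 𝔹 k).symm i).2.1.src ∨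
          iterBlockOf (((constrEnum 𝔹 k).symm i).1 : ℕ) b₀.src = ((constrEnum 𝔹 k).symm i).2.1.tgt) →
        (iterBlockOf (((constrEnum 𝔹 k).symm i).1 : ℕ) b₀.tgt = ((constrEnum 𝔹 k).symm i).2.1.src ∨
          iterBlockOf (((constrEnum 𝔹 k).symm i).1 : ℕ) b₀.tgt = ((constrEnum 𝔹 k).symm i).2.1.tgt) → U' b₀ = U₀ b₀)
    {path : Site (F.P K) 0 → List (LStep (F.P K) 0)}
    (hroot : ∀ r ∈ {z : Site (F.P K) 0 | ∃ j, j ≤ k ∧ ∃ c ∈ bondsOf (𝔹 j), (z = embIter j c.src ∨ z = embIter j c.tgt)}, path r = [])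
    (hF1 : ∀ x, ∀ s ∈ path x, ∃ x' x'' : Site (F.P K) 0, path x'' = path x' ++ [s] ∧
      (s.fwd = true → s.bond.src = x' ∧ s.bond.tgt = x'') ∧ (s.fwd = false → s.bond.src = x'' ∧ s.bond.tgt = x'))
    {Lp : ℕ} (hlen : ∀ x, (path x).length ≤ Lp) (X₀ : PBond (F.P K) 0 → lieSU (Fin N)) :
    ∃ X : PBond (F.P K) 0 → lieSU (Fin N), (∀ x, ∀ s ∈ path x, X s.bond = 0) ∧
      fderiv ℝ (msChart F N K k 𝔹 W U₀) 0 X = fderiv ℝ (msChart F N K k 𝔹 W U₀) 0 X₀ ∧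
      ∑ b, ‖(X b : Matrix (Fin N) (Fin N) ℂ)‖ ≤ (1 + 2 * (Fintype.card (PBond (F.P K) 0)) * Lp) * ∑ b, ‖(X₀ b : Matrix (Fin N) (Fin N) ℂ)‖ := by
  obtain ⟨ξ, hξR, hvan, -, hl1⟩ := exists_forestProjection_l1 U₀ hroot hF1 hlen X₀
  -- the orbit tangent of `ξ` lies in `ker DΨ_{U₀}(0)`
  have hT : fderiv ℝ (msChart F N K k 𝔹 W U₀) 0 (fun b => specialUnitaryAd (U₀ b)⁻¹ (ξ b.src) - ξ b.tgt) = 0 := by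
    funext i
    rw [Pi.zero_apply]
    have hj : (((constrEnum 𝔹 k).symm i).1 : ℕ) ≤ k := Nat.le_of_lt_succ ((constrEnum 𝔹 k).symm i).1.isLt
    have hc : ((constrEnum 𝔹 k).symm i).2.1 ∈ bondsOf (𝔹 ((constrEnum 𝔹 k).symm i).1) := ((constrEnum 𝔹 k).symm i).2.2
    have hsrc : ξ (embIter ((constrEnum 𝔹 k).symm i).1 ((constrEnum 𝔹 k).symm i).2.1.src) = 0 := hξR _ ⟨_, hj, _, hc, Or.inl rfl⟩
    have htgt : ξ (embIter ((constrEnum 𝔹 k).symm i).1 ((constrEnum 𝔹 k).symm i).2.1.tgt) = 0 := hξR _ ⟨_, hj, _, hc, Or.inr rfl⟩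
    rcases Nat.eq_zero_or_pos (((constrEnum 𝔹 k).symm i).1 : ℕ) with h0 | hpos
    · refine fderiv_msChart_apply_eq_zero_of_vanish_sharp' hk hΨ _ i fun b₀ hs ht => ?_
      have hs' : ξ b₀.src = 0 := by
        rw [← embIter_iterBlockOf_of_eq_zero h0 b₀.src]
        rcases hs with h | h
        · rw [h]; exact hsrc
        · rw [h]; exact htgt
      have ht' : ξ b₀.tgt = 0 := by
        rw [← embIter_iterBlockOf_of_eq_zero h0 b₀.tgt]
        rcases ht with h | h
        · rw [h]; exact hsrc
        · rw [h]; exact htgt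
      simp only [hs', ht', map_zero, sub_zero]
    · obtain ⟨U', hsb', hin⟩ := hsharp i hpos
      exact fderiv_msChart_orbitTangent_apply_eq_zero_of_sharpProxy hk hU hΨ hsb' i hin ξ hsrc htgt
  refine ⟨fun b => X₀ b - (specialUnitaryAd (U₀ b)⁻¹ (ξ b.src) - ξ b.tgt), hvan, ?_, hl1⟩
  have hsub : (fun b => X₀ b - (specialUnitaryAd (U₀ b)⁻¹ (ξ b.src) - ξ b.tgt)) =
      X₀ - fun b => specialUnitaryAd (U₀ b)⁻¹ (ξ b.src) - ξ b.tgt := rfl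
  rw [hsub, map_sub, hT, sub_zero]

end Companion

/-! ## §2  With a lettered right inverse: slice preimages with an `ℓ¹` letter and their level-`0` support -/

section Lettered

/-- `Σ_b‖↑Y_b‖_op ≤ √#bonds·B·‖v‖` from the `ℓ²(HS)` letter `√(Σ_b‖Y_b‖²) ≤ B‖v‖` (Cauchy–Schwarz, operator norm `≤` Hilbert–Schmidt norm). [cite: Balaban1985Averaging, (17)–(19) pp.20–21 (bookkeeping)] -/
theorem sum_opNorm_le_of_l2Letter (Y : PBond (F.P K) 0 → lieSU (Fin N)) {B t : ℝ} (hY : Real.sqrt (∑ b, ‖Y b‖ ^ 2) ≤ B * t) :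
    ∑ b, ‖(Y b : Matrix (Fin N) (Fin N) ℂ)‖ ≤ Real.sqrt (Fintype.card (PBond (F.P K) 0)) * (B * t) := by
  have h := sum_opNorm_le_sqrt_card_mul_l2Seminorm (N := N) Y
  rw [l2Seminorm_apply] at h
  exact h.trans (mul_le_mul_of_nonneg_left hY (Real.sqrt_nonneg _))

/-- ★★ **SLICE PREIMAGES WITH AN `ℓ¹` LETTER FROM A LETTERED RIGHT INVERSE**: under the hypotheses of `exists_forest_preimage_l1_of_proxies`, a right inverse `H` of `DΨ_{U₀}(0)` with the
`ℓ²(HS)` letter `√(Σ_b‖H v b‖²) ≤ B‖v‖` (this lineage's (P4)′ shape, p678596 ∕ p690553 ∕ p705019) gives every datum `τ` a preimage `X` vanishing on every path bond with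
`Σ_b‖↑X_b‖_op ≤ ((1 + 2·#bonds·Lp)·√#bonds·B)·‖τ‖`. [cite: Balaban1985Variational, Sect. C (45)–(46) p.285, (82)–(83) p.290; Balaban1988Convergent, (2.10)–(2.11) p.256] -/
theorem exists_forest_preimage_l1_of_rightInverse (𝔹 : DetSet (F.P K)) (hk : k ≤ (F.P K).m + (F.P K).K)
    {W : MSField (F.P K) (SU N)} {U₀ : GaugeField (F.P K) 0 (SU N)} (hU : AgreeOn 𝔹 (avgFamily (avOfRecord F N K) U₀) W)
    (hΨ : DifferentiableAt ℝ (msChart F N K k 𝔹 W U₀) 0)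
    (hsharp : ∀ i : Fin (constrCard 𝔹 k), 1 ≤ (((constrEnum 𝔹 k).symm i).1 : ℕ) → ∃ U' : GaugeField (F.P K) 0 (SU N),
      SmallBelow (avOfRecord F N K) k U' ∧ ∀ b₀ : PBond (F.P K) 0,
        (iterBlockOf (((constrEnum 𝔹 k).symm i).1 : ℕ) b₀.src = ((constrEnum 𝔹 k).symm i).2.1.src ∨
          iterBlockOf (((constrEnum 𝔹 k).symm i).1 : ℕ) b₀.src = ((constrEnum 𝔹 k).symm i).2.1.tgt) →
        (iterBlockOf (((constrEnum 𝔹 k).symm i).1 : ℕ) b₀.tgt = ((constrEnum 𝔹 k).symm i).2.1.src ∨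
          iterBlockOf (((constrEnum 𝔹 k).symm i).1 : ℕ) b₀.tgt = ((constrEnum 𝔹 k).symm i).2.1.tgt) → U' b₀ = U₀ b₀)
    {path : Site (F.P K) 0 → List (LStep (F.P K) 0)}
    (hroot : ∀ r ∈ {z : Site (F.P K) 0 | ∃ j, j ≤ k ∧ ∃ c ∈ bondsOf (𝔹 j), (z = embIter j c.src ∨ z = embIter j c.tgt)}, path r = [])
    (hF1 : ∀ x, ∀ s ∈ path x, ∃ x' x'' : Site (F.P K) 0, path x'' = path x' ++ [s] ∧
      (s.fwd = true → s.bond.src = x' ∧ s.bond.tgt = x'') ∧ (s.fwd = false → s.bond.src = x'' ∧ s.bond.tgt = x'))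
    {Lp : ℕ} (hlen : ∀ x, (path x).length ≤ Lp)
    (H : (Fin (constrCard 𝔹 k) → lieSU (Fin N)) → PBond (F.P K) 0 → lieSU (Fin N)) {B : ℝ}
    (hHinv : ∀ v, fderiv ℝ (msChart F N K k 𝔹 W U₀) 0 (H v) = v) (hHB : ∀ v, Real.sqrt (∑ b, ‖H v b‖ ^ 2) ≤ B * ‖v‖)
    (τ : Fin (constrCard 𝔹 k) → lieSU (Fin N)) :
    ∃ X : PBond (F.P K) 0 → lieSU (Fin N), (∀ x, ∀ s ∈ path x, X s.bond = 0) ∧ fderiv ℝ (msChart F N K k 𝔹 W U₀) 0 X = τ ∧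
      ∑ b, ‖(X b : Matrix (Fin N) (Fin N) ℂ)‖ ≤ ((1 + 2 * (Fintype.card (PBond (F.P K) 0)) * Lp) * Real.sqrt (Fintype.card (PBond (F.P K) 0)) * B) * ‖τ‖ := by
  obtain ⟨X, hXS, hXim, hXl1⟩ := exists_forest_preimage_l1_of_proxies 𝔹 hk hU hΨ hsharp hroot hF1 hlen (H τ)
  refine ⟨X, hXS, by rw [hXim, hHinv], hXl1.trans ?_⟩
  have h1 := sum_opNorm_le_of_l2Letter (N := N) (H τ) (hHB τ)
  have hc : 0 ≤ (1 + 2 * (Fintype.card (PBond (F.P K) 0) : ℝ) * Lp) := by positivity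
  calc (1 + 2 * (Fintype.card (PBond (F.P K) 0) : ℝ) * Lp) * ∑ b, ‖(H τ b : Matrix (Fin N) (Fin N) ℂ)‖
      ≤ (1 + 2 * (Fintype.card (PBond (F.P K) 0) : ℝ) * Lp) * (Real.sqrt (Fintype.card (PBond (F.P K) 0)) * (B * ‖τ‖)) := mul_le_mul_of_nonneg_left h1 hc
    _ = ((1 + 2 * (Fintype.card (PBond (F.P K) 0)) * Lp) * Real.sqrt (Fintype.card (PBond (F.P K) 0)) * B) * ‖τ‖ := by ring

/-- **A PREIMAGE OF A DATUM NOT CHARGING THE LEVEL-`0` ROW OF `c` VANISHES AT `c`** (`c ∈ bondsOf (𝐁 0)`): the `Γ₀` layer of `DΨ_{U₀}(0)` is the evaluation (dag-n12-w4's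
`Node00.fderiv_msChart_apply_levelZero`, [III] (2.11) `M⁰ = id`). [cite: Balaban1988Convergent, (2.2) p.255, (2.11) p.256; Balaban1985Variational, (82)–(83) p.290] -/
theorem apply_eq_zero_of_preimage_levelZero {𝔹 : DetSet (F.P K)} {W : MSField (F.P K) (SU N)} {U₀ : GaugeField (F.P K) 0 (SU N)}
    (hU : AgreeOn 𝔹 (avgFamily (avOfRecord F N K) U₀) W) (hΨ : DifferentiableAt ℝ (msChart F N K k 𝔹 W U₀) 0)
    {X : PBond (F.P K) 0 → lieSU (Fin N)} {τ : Fin (constrCard 𝔹 k) → lieSU (Fin N)} (hX : fderiv ℝ (msChart F N K k 𝔹 W U₀) 0 X = τ)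
    (c : PBond (F.P K) 0) (hc : c ∈ bondsOf (𝔹 0)) (hτ : τ (constrEnum 𝔹 k ⟨⟨0, Nat.succ_pos k⟩, c, hc⟩) = 0) : X c = 0 := by
  rw [← fderiv_msChart_apply_levelZero hU hΨ c hc X, hX, hτ]

/-- ★★ **SLICE PREIMAGES WITH `ℓ¹` LETTER AND LEVEL-`0` SUPPORT**: as `exists_forest_preimage_l1_of_rightInverse`, and in addition `X c = 0` at every `c ∈ bondsOf (𝐁 0)` whose level-`0`
row the datum `τ` does not charge. [cite: Balaban1985Variational, Sect. C (45)–(46) p.285, (82)–(83) p.290; Balaban1988Convergent, (2.2) p.255, (2.10)–(2.11) p.256] -/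
theorem exists_forest_preimage_l1_support_of_rightInverse (𝔹 : DetSet (F.P K)) (hk : k ≤ (F.P K).m + (F.P K).K)
    {W : MSField (F.P K) (SU N)} {U₀ : GaugeField (F.P K) 0 (SU N)} (hU : AgreeOn 𝔹 (avgFamily (avOfRecord F N K) U₀) W)
    (hΨ : DifferentiableAt ℝ (msChart F N K k 𝔹 W U₀) 0)
    (hsharp : ∀ i : Fin (constrCard 𝔹 k), 1 ≤ (((constrEnum 𝔹 k).symm i).1 : ℕ) → ∃ U' : GaugeField (F.P K) 0 (SU N),
      SmallBelow (avOfRecord F N K) k U' ∧ ∀ b₀ : PBond (F.P K) 0,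
        (iterBlockOf (((constrEnum 𝔹 k).symm i).1 : ℕ) b₀.src = ((constrEnum 𝔹 k).symm i).2.1.src ∨
          iterBlockOf (((constrEnum 𝔹 k).symm i).1 : ℕ) b₀.src = ((constrEnum 𝔹 k).symm i).2.1.tgt) →
        (iterBlockOf (((constrEnum 𝔹 k).symm i).1 : ℕ) b₀.tgt = ((constrEnum 𝔹 k).symm i).2.1.src ∨
          iterBlockOf (((constrEnum 𝔹 k).symm i).1 : ℕ) b₀.tgt = ((constrEnum 𝔹 k).symm i).2.1.tgt) → U' b₀ = U₀ b₀)
    {path : Site (F.P K) 0 → List (LStep (F.P K) 0)}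
    (hroot : ∀ r ∈ {z : Site (F.P K) 0 | ∃ j, j ≤ k ∧ ∃ c ∈ bondsOf (𝔹 j), (z = embIter j c.src ∨ z = embIter j c.tgt)}, path r = [])
    (hF1 : ∀ x, ∀ s ∈ path x, ∃ x' x'' : Site (F.P K) 0, path x'' = path x' ++ [s] ∧
      (s.fwd = true → s.bond.src = x' ∧ s.bond.tgt = x'') ∧ (s.fwd = false → s.bond.src = x'' ∧ s.bond.tgt = x'))
    {Lp : ℕ} (hlen : ∀ x, (path x).length ≤ Lp)
    (H : (Fin (constrCard 𝔹 k) → lieSU (Fin N)) → PBond (F.P K) 0 → lieSU (Fin N)) {B : ℝ}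
    (hHinv : ∀ v, fderiv ℝ (msChart F N K k 𝔹 W U₀) 0 (H v) = v) (hHB : ∀ v, Real.sqrt (∑ b, ‖H v b‖ ^ 2) ≤ B * ‖v‖)
    (τ : Fin (constrCard 𝔹 k) → lieSU (Fin N)) :
    ∃ X : PBond (F.P K) 0 → lieSU (Fin N), (∀ x, ∀ s ∈ path x, X s.bond = 0) ∧ fderiv ℝ (msChart F N K k 𝔹 W U₀) 0 X = τ ∧
      ∑ b, ‖(X b : Matrix (Fin N) (Fin N) ℂ)‖ ≤ ((1 + 2 * (Fintype.card (PBond (F.P K) 0)) * Lp) * Real.sqrt (Fintype.card (PBond (F.P K) 0)) * B) * ‖τ‖ ∧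
      ∀ (c : PBond (F.P K) 0) (hc : c ∈ bondsOf (𝔹 0)), τ (constrEnum 𝔹 k ⟨⟨0, Nat.succ_pos k⟩, c, hc⟩) = 0 → X c = 0 := by
  obtain ⟨X, hXS, hXim, hXl1⟩ := exists_forest_preimage_l1_of_rightInverse 𝔹 hk hU hΨ hsharp hroot hF1 hlen H hHinv hHB τ
  exact ⟨X, hXS, hXim, hXl1, fun c hc hτ => apply_eq_zero_of_preimage_levelZero hU hΨ hXim c hc hτ⟩

end Lettered

/-! ## §3  At the record: every (2.12)-class minimiser, proxies and right inverse read off the class -/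

section Record

/-- ★★★ **SLICE PREIMAGES WITH `ℓ¹` LETTER AND `Γ₀`-SUPPORT FOR EVERY CLASS MINIMISER** — at the record's `𝐁_k(Z)` (`0 < k`), a (2.12)-class minimiser `U₀` (class membership only is
read: the per-row proxies `towerProxies_Bj_of_mem_class` ∕ `siteProxies_Bj_of_mem_class` and the lettered right inverse `exists_rightInverse_Bj_of_isMinimizer_class`), any datum `W` with
`U₀` in its fibre, a rooted forest with (F1) at the centres `R(𝐁_k(Z), k)` and paths of length `≤ Lp`: every datum `τ` has a preimage `X` under `DΨ_{U₀}(0)` VANISHING ON EVERY PATH BOND,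
with `Σ_b‖↑X_b‖_op ≤ ((1 + 2·#bonds·Lp)·√#bonds·B)·‖τ‖`, and `X b = 0` at every `Γ₀`-bond `b ∈ bondsOf (𝐁_k(Z) 0)` (= the bonds with an end-point off `Ω₁(Z)` for `0 < k`,
`N12RightInverseLevelZeroLocality.mem_bondsOf_Bj_zero`) whose level-`0` row `τ` does not charge.  Per-HEIGHT letters
only: `hHB`'s ∀-body at `(εH, B)`, `hsbU` at `ρ″`, the floors, `Lp`. [cite: Balaban1985Variational, Sect. C (44)–(48) p.285, (82)–(83) p.290; Balaban1988Convergent, (2.2) p.255, (2.10)–(2.13) pp.256–257] -/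
theorem exists_forest_preimage_l1_support_Bj_of_isMinimizer_class (ν : Node00.Stage7Numerics) (Kt : ℕ) (Z : Set (Site (F.P Kt) 0))
    (hkK : k + 1 ≤ (F.P Kt).m + (F.P Kt).K) (hM4 : 4 * (F.P Kt).L ≤ ν.M₁) (hdiv : side (F.P Kt).L ν.M₁ k ∣ (F.P Kt).sitesPerDir 0) (hε : 0 ≤ ν.εreg)
    {ρ'' : ℝ} (hsbU : ∀ V : GaugeField (F.P Kt) 0 SU2, ‖coeField V - 1‖ ≤ ρ'' → SmallBelow (avOfRecord F 2 Kt) k V)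
    (hερ : 6 * ((((F.P Kt).d - 1 : ℕ)) : ℝ) * (F.P Kt).L * ν.εreg ≤ ρ'')
    {εH B : ℝ}
    (hHB : ∀ (Wd : MSField (F.P Kt) SU2) (U₀ : GaugeField (F.P Kt) 0 SU2),
      AgreeOn (Bj ν.M₁ Z k) (avgFamily (avOfRecord F 2 Kt) U₀) Wd →
      (∀ i' : Fin (constrCard (Bj ν.M₁ Z k) k), ∃ U' : GaugeField (F.P Kt) 0 SU2,
        (∀ b ∈ feeds (((constrEnum (Bj ν.M₁ Z k) k).symm i').1 : ℕ) ((constrEnum (Bj ν.M₁ Z k) k).symm i').2.1, U' b = U₀ b) ∧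
          SmallBelow (avOfRecord F 2 Kt) k U') →
      (∀ (j : ℕ), 1 ≤ j → j ≤ k → ∀ y : Site (F.P Kt) j, embIter j y ∈ maxDomT ν.M₁ Z j → ∃ U' : GaugeField (F.P Kt) 0 SU2,
        (∀ c : PBond (F.P Kt) j, (c.src = y ∨ c.tgt = y) → ∀ b₀ : PBond (F.P Kt) 0,
          (iterBlockOf j b₀.src = c.src ∨ iterBlockOf j b₀.src = c.tgt) → (iterBlockOf j b₀.tgt = c.src ∨ iterBlockOf j b₀.tgt = c.tgt) → U' b₀ = U₀ b₀) ∧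
        SmallBelow (avOfRecord F 2 Kt) k U') →
      (∀ (j : ℕ), 1 ≤ j → j ≤ k → ∀ y : Site (F.P Kt) j, embIter j y ∈ maxDomT ν.M₁ Z j →
        PlaqSmallOn (boxPlaqs (fun κ => lift (F.P Kt) (embIter j y) κ - ((((F.P Kt).L ^ j : ℕ) : ℤ) + ((((F.P Kt).L ^ j - 1) / 2 : ℕ) : ℤ)))
          (fun κ => lift (F.P Kt) (embIter j y) κ + ((((F.P Kt).L ^ j : ℕ) : ℤ) + ((((F.P Kt).L ^ j - 1) / 2 : ℕ) : ℤ))) : Set (Plaq (F.P Kt) 0)) εH U₀) →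
      ∃ H : (Fin (constrCard (Bj ν.M₁ Z k) k) → lieSU (Fin 2)) → PBond (F.P Kt) 0 → lieSU (Fin 2),
        (∀ v, fderiv ℝ (msChart F 2 Kt k (Bj ν.M₁ Z k) Wd U₀) 0 (H v) = v) ∧ ∀ v, Real.sqrt (∑ b, ‖H v b‖ ^ 2) ≤ B * ‖v‖)
    (hεH : ν.εreg ≤ εH)
    -- the minimiser (class membership only) and the datum
    {𝔹' : DetSet (F.P Kt)} {W' : MSField (F.P Kt) SU2} {U₀ : GaugeField (F.P Kt) 0 SU2}
    (hmin : IsMinimizer (avOfRecord F 2 Kt) (regMSCoPOfRecord F 2 ν Kt k (maxDomT ν.M₁ Z)) 𝔹' W' U₀)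
    {W : MSField (F.P Kt) SU2} (hW : AgreeOn (Bj ν.M₁ Z k) (avgFamily (avOfRecord F 2 Kt) U₀) W)
    -- the rooted forest
    {path : Site (F.P Kt) 0 → List (LStep (F.P Kt) 0)}
    (hroot : ∀ r ∈ {z : Site (F.P Kt) 0 | ∃ j, j ≤ k ∧ ∃ c ∈ bondsOf ((Bj ν.M₁ Z k : DetSet (F.P Kt)) j), (z = embIter j c.src ∨ z = embIter j c.tgt)}, path r = [])
    (hF1 : ∀ x, ∀ s ∈ path x, ∃ x' x'' : Site (F.P Kt) 0, path x'' = path x' ++ [s] ∧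
      (s.fwd = true → s.bond.src = x' ∧ s.bond.tgt = x'') ∧ (s.fwd = false → s.bond.src = x'' ∧ s.bond.tgt = x'))
    {Lp : ℕ} (hlen : ∀ x, (path x).length ≤ Lp)
    (τ : Fin (constrCard (Bj ν.M₁ Z k : DetSet (F.P Kt)) k) → lieSU (Fin 2)) :
    ∃ X : PBond (F.P Kt) 0 → lieSU (Fin 2), (∀ x, ∀ s ∈ path x, X s.bond = 0) ∧ fderiv ℝ (msChart F 2 Kt k (Bj ν.M₁ Z k) W U₀) 0 X = τ ∧
      ∑ b, ‖(X b : Matrix (Fin 2) (Fin 2) ℂ)‖ ≤ ((1 + 2 * (Fintype.card (PBond (F.P Kt) 0)) * Lp) * Real.sqrt (Fintype.card (PBond (F.P Kt) 0)) * B) * ‖τ‖ ∧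
      ∀ (b : PBond (F.P Kt) 0) (hb : b ∈ bondsOf ((Bj ν.M₁ Z k : DetSet (F.P Kt)) 0)),
        τ (constrEnum (Bj ν.M₁ Z k : DetSet (F.P Kt)) k ⟨⟨0, Nat.succ_pos k⟩, b, hb⟩) = 0 → X b = 0 := by
  have hk : k ≤ (F.P Kt).m + (F.P Kt).K := by omega
  -- the class supplies the proxies and the lettered right inverse
  have hprox := towerProxies_Bj_of_mem_class ν Kt Z hkK hM4 hdiv hε hsbU hερ hmin.1
  have hproxSite := siteProxies_Bj_of_mem_class ν Kt Z hkK hM4 hdiv hε hsbU hερ hmin.1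
  obtain ⟨H, hHinv, hHB'⟩ := exists_rightInverse_Bj_of_isMinimizer_class ν Kt Z hkK hM4 hdiv hε hsbU hερ hHB hεH hmin hW
  have hΨ : DifferentiableAt ℝ (msChart F 2 Kt k (Bj ν.M₁ Z k) W U₀) 0 := differentiableAt_msChart_of_towerProxies hk hW hprox
  -- sharp proxies for the rows of positive level, from the site proxies at the row's inner end-point
  have hsharp : ∀ i : Fin (constrCard (Bj ν.M₁ Z k : DetSet (F.P Kt)) k), 1 ≤ (((constrEnum (Bj ν.M₁ Z k) k).symm i).1 : ℕ) → ∃ U' : GaugeField (F.P Kt) 0 SU2,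
      SmallBelow (avOfRecord F 2 Kt) k U' ∧ ∀ b₀ : PBond (F.P Kt) 0,
        (iterBlockOf (((constrEnum (Bj ν.M₁ Z k) k).symm i).1 : ℕ) b₀.src = ((constrEnum (Bj ν.M₁ Z k) k).symm i).2.1.src ∨
          iterBlockOf (((constrEnum (Bj ν.M₁ Z k) k).symm i).1 : ℕ) b₀.src = ((constrEnum (Bj ν.M₁ Z k) k).symm i).2.1.tgt) →
        (iterBlockOf (((constrEnum (Bj ν.M₁ Z k) k).symm i).1 : ℕ) b₀.tgt = ((constrEnum (Bj ν.M₁ Z k) k).symm i).2.1.src ∨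
          iterBlockOf (((constrEnum (Bj ν.M₁ Z k) k).symm i).1 : ℕ) b₀.tgt = ((constrEnum (Bj ν.M₁ Z k) k).symm i).2.1.tgt) → U' b₀ = U₀ b₀ := by
    intro i hpos
    have hjk : (((constrEnum (Bj ν.M₁ Z k) k).symm i).1 : ℕ) ≤ k := Nat.le_of_lt_succ ((constrEnum (Bj ν.M₁ Z k) k).symm i).1.isLt
    have hc : ((constrEnum (Bj ν.M₁ Z k) k).symm i).2.1 ∈ bondsOf ((Bj ν.M₁ Z k : DetSet (F.P Kt)) ((constrEnum (Bj ν.M₁ Z k) k).symm i).1) :=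
      ((constrEnum (Bj ν.M₁ Z k) k).symm i).2.2
    rcases inner_endpoint_of_mem_bondsOf_Bj hpos hjk hc with hy | hy
    · obtain ⟨U', hag, hsb'⟩ := hproxSite _ hpos hjk _ hy
      exact ⟨U', hsb', hag _ (Or.inl rfl)⟩
    · obtain ⟨U', hag, hsb'⟩ := hproxSite _ hpos hjk _ hy
      exact ⟨U', hsb', hag _ (Or.inr rfl)⟩
  obtain ⟨X, hXS, hXim, hXl1, hX0⟩ := exists_forest_preimage_l1_support_of_rightInverse (Bj ν.M₁ Z k) hk hW hΨ hsharp hroot hF1 hlen H hHinv hHB' τ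
  exact ⟨X, hXS, hXim, hXl1, hX0⟩

end Record

end Summit.QuantumFields.YangMills.BalabanUVNodes.N12ForestPreimageL1Letter

end
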